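/-
Copyright (c) 2026 the pub-hodgecm-mathlib formalisation cell (harness21).  Prover seat hodgecm-mathlib-K2E1-p11 (g4), Track B ∕ K2-LIT, h413 = `stmt-HodgeConjecture-24833`,
R90-TF section S8 «ContSpec-n½», #2 road (G side), S8 dealer R90-CS-plan (g3) S8-R136 (3) «NON-ZERO SECTION WITNESS AT A LEVEL» (census
`R90/S8/CENSUS-ChiSectionPairNonzeroWitness.K2E1-p11-g4.md` f84e71c9c4f7f19b, FILE 1 = GLUE): from an ARCHIMEDEAN section `Φa` on `G_∞` and a FINITE-ADELIC section `Φf` on `G(𝔸_f)` at an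
open-or-not level `Kf` with compatible Borel multipliers `ca · cf = (χ₁, χ₂)`, the product `g ↦ Φa(g_∞)·Φf(g_f)` is a continuous non-zero `(χ₁, χ₂)`-pair-section at the level `(ι_f(Kf), 1)` —
the EXPORT `∃ K′ ω φ, φ ∈ V(χ₁, χ₂; K′, ω) ∧ Continuous φ ∧ φ 1 ≠ 0` of the (V) discharge table row (i), hypothesis-first on the two letters its FILES 2–3 pay.
-/
import Summits.HodgeConjecture.HodgeConjecture.Theorems.K2E1ChiSectionSpaceU3PairDefs   -- ★ p862227 (D-S8-3′): `chiSectionSpacePair χ₁ χ₂ K′ ω`, `mem_chiSectionSpacePair`; brings ★ `IsChiSectionPair`, `firstEntryUnit`, `middleEntryUnitary`, `borelAdelic`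
import Literature.NumberTheory.Automorphic.UnitaryGroupAdelicProduct                     -- ★ `archPart`, `finPart` (continuous homs), `archPart_finAdelicToAdelic`, `finPart_finAdelicToAdelic`
import HarnessLib

/-!
# S8 #2 road (G side) — `R90S8ChiSectionPairNonzeroWitnessU3OfLetters`: the NON-ZERO `(χ₁, χ₂)`-PAIR-SECTION WITNESS AT A LEVEL, HYPOTHESIS-FIRST on an archimedean section `Φa` and a
# finite-adelic section `Φf` — `φ(g) := Φa(g_∞)·Φf(g_f) ∈ V(χ₁, χ₂; ι_f(Kf), 1)`, continuous, `φ 1 ≠ 0`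

Track B ∕ K2-LIT, crux h413 = `stmt-HodgeConjecture-24833`, route of record `HCCMUnconditional`; cell `hodgecm-mathlib`, R90-TF programme, section S8 «ContSpec-n½», socket (V)
`sock_S8_res_midBlock_ne_bot` (`Lines/R90_S8_ResidualSpectrumU3B.lean` :300), discharge table `R90/S8/CENSUS-V-DischargeTable.K2E2-p12-g9.md` 3df908fcf11ad296 row (i) «`φ hφ hφc` — CHOICE of a
NON-ZERO continuous `φ ∈ V(ξ.bcη⁻¹·ξ.bcψ⁻¹·μω, ξ.ψ; K′, ω)` — NOT ★ at N = 3».  THEOREMS ONLY (no `def`, no `instance`, no `notation`, no named-fact hypothesis, no `sorry`; default heartbeats); lane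
`--supports stmt-HodgeConjecture-24833 --as helper` (count-neutral).  CLOSES NO SOCKET: it freezes the witness's INTERFACE for the (V) assembly (K2E2-p12) with two visible letters —
`hΦa…` (the archimedean section; census road (A): the last-row model `c_w(x₃)·|x₃|∕‖x‖·χ₂,w(det)`, FILE 3) and `hΦf…` (the finite-adelic level section `χ_f(b)·𝟙_{B(𝔸_f)K_f}`, FILE 2).

THE MATHEMATICS ([BorelJacquet1979, §4.1]; [MoeglinWaldspurger1995, I.2.17]).  `G(𝔸) = G_∞ × G(𝔸_f)` with commuting factors and CONTINUOUS component homomorphisms `g ↦ g_∞`, `g ↦ g_f` (★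
`archPart`, `finPart`).  Let `Φa : G_∞ → ℂ`, `Φf : G(𝔸_f) → ℂ` be continuous with `Φa(b_∞ a) = ca(b)·Φa(a)`, `Φf(b_f u) = cf(b)·Φf(u)` for every adelic Borel `b ∈ B(𝔸)` (multipliers `ca b`, `cf b`
with `ca b · cf b = χ₁(b₀₀)·χ₂(b₁₁)` — the archimedean and finite components of the Borel character; how the payers split the ideles is THEIR business, the glue only uses the product), `Φf`
right-invariant under `Kf ≤ G(𝔸_f)`, and `Φa(1)·Φf(1) ≠ 0`.  Then `φ(g) := Φa(g_∞)·Φf(g_f)` satisfies `φ(bg) = ca(b)cf(b)·φ(g) = χ₁(b₀₀)χ₂(b₁₁)·φ(g)` (★ `IsChiSectionPair`), `φ(g·ι_f(u)) = φ(g)` for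
`u ∈ Kf` (`(ι_f u)_∞ = 1`, `(ι_f u)_f = u` ★), is continuous, and `φ(1) ≠ 0` — i.e. `φ ∈ V(χ₁, χ₂; Kf.map ι_f, 1)` (★ `chiSectionSpacePair`, `ω := 1`), the cheapest admissible level of the
census (no archimedean level: the right law of `chiSectionSpacePair` is a one-dimensional eigen-law, so `K_∞`-matrix coefficients are not admissible, and none is needed).
* §1 `archFin_isChiSectionPair`, `archFin_apply_mul_finAdelicToAdelic`, `archFin_mem_chiSectionSpacePair`, `continuous_archFin`, `archFin_apply_one` — the product section, letter by letter
  (stated on the explicit lambda `fun g => Φa (archPart … g) * Φf (finPart … g)`; no definition is introduced).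
* §2 **`exists_chiSectionPair_continuous_apply_one_ne_zero_of_letters`** — THE EXPORT `∃ K′ (ω : K′ →* ℂ) φ, φ ∈ chiSectionSpacePair χ₁ χ₂ K′ ω ∧ Continuous φ ∧ φ 1 ≠ 0` (row (i) bytes),
  and the level-visible form **`exists_mem_chiSectionSpacePair_map_finAdelicToAdelic_of_letters`** (`K′ := Kf.map ι_f`, `ω := 1`) for consumers who key the atom `resGMidAtom ξ μω K′ ω` to it.
HONEST LABEL: HC_CM is proved only modulo the 7 printed citations (2 remaining named inputs: hLiu418 = `stmt-HodgeConjecture-24832`, h413 = `stmt-HodgeConjecture-24833`) until rung 0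
closes; REL ≠ ★ ≠ BUILT; this file asserts no named fact, is conditional by construction on its visible binders (`Φa`, `Φf` and their laws), and closes no socket; count-neutral.

## References
* [BorelJacquet1979] A. Borel, H. Jacquet, *Automorphic forms and automorphic representations*, Corvallis PSPM 33.1 (1979), §4.1.
* [MoeglinWaldspurger1995] C. Mœglin, J.-L. Waldspurger, *Spectral Decomposition and Eisenstein Series* (1995), I.2.17.
-/

set_option autoImplicit false
set_option linter.dupNamespace false  -- the mandated namespace `…HodgeConjecture.HodgeConjecture.R90.S8` (LEAD #1 L1) repeats the summit's segment

noncomputable section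

open NumberField Topology
open Literature.NumberTheory.Automorphic Literature.NumberTheory.Automorphic.UnitaryGroup Literature.NumberTheory.GaloisRepresentations AdelicGroupData
open Literature.NumberTheory.Automorphic.Arthur2013.Leaves.TECR
open Summit.HodgeConjecture.HodgeConjecture.Cruxes.H413.K2E1CharacterEisensteinU2Defs
open Summit.HodgeConjecture.HodgeConjecture.Cruxes.H413.K2E1CharacterEisensteinU3PairDefs
open Summit.HodgeConjecture.HodgeConjecture.Cruxes.H413.K2E1ChiSectionSpaceU3PairDefs

namespace Summit.HodgeConjecture.HodgeConjecture.R90.S8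

section Glue

variable (L : Type) [Field L] [NumberField L] [IsCMField L]
  {χ₁ : HeckeCharacter L} {χ₂ : ↥(TorusDict.torus (IsCMField.complexConj L)) →ₜ* ℂˣ}
  (ca cf : (quasiSplit (↥(maximalRealSubfield L)) L (IsCMField.complexConj L) 3).Adelic → ℂ)
  (Φa : arch (↥(maximalRealSubfield L)) L (IsCMField.complexConj L) 3 ((StdForm.antidiagonal 3).over L) → ℂ)
  (Φf : finAdelic (↥(maximalRealSubfield L)) L (IsCMField.complexConj L) 3 ((StdForm.antidiagonal 3).over L) → ℂ)
  (Kf : Subgroup ↥(finAdelic (↥(maximalRealSubfield L)) L (IsCMField.complexConj L) 3 ((StdForm.antidiagonal 3).over L)))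

/-! ## §1 The product section `g ↦ Φa(g_∞)·Φf(g_f)`, letter by letter -/

/-- **`φ(bg) = χ₁(b₀₀)χ₂(b₁₁)·φ(g)`** for `φ(g) := Φa(g_∞)·Φf(g_f)`: the archimedean letter `hΦaB` (`Φa(b_∞ a) = ca(b)Φa(a)`), the finite letter `hΦfB` (`Φf(b_f u) = cf(b)Φf(u)`) and the
multiplier identity `hc` (`ca b · cf b = χ₁(b₀₀)χ₂(b₁₁)`); `(bg)_∞ = b_∞ g_∞`, `(bg)_f = b_f g_f` (★ homs `archPart`, `finPart`). [cite: BorelJacquet1979, §4.1] [cite: MoeglinWaldspurger1995, I.2.17] -/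
theorem archFin_isChiSectionPair
    (hc : ∀ (b : (quasiSplit (↥(maximalRealSubfield L)) L (IsCMField.complexConj L) 3).Adelic) (hb : b ∈ borelAdelic (↥(maximalRealSubfield L)) L (IsCMField.complexConj L) 3),
      ca b * cf b = ((χ₁ (firstEntryUnit hb) : ℂˣ) : ℂ) * ((χ₂ (middleEntryUnitary hb) : ℂˣ) : ℂ))
    (hΦaB : ∀ (b : (quasiSplit (↥(maximalRealSubfield L)) L (IsCMField.complexConj L) 3).Adelic), b ∈ borelAdelic (↥(maximalRealSubfield L)) L (IsCMField.complexConj L) 3 →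
      ∀ a, Φa (archPart (↥(maximalRealSubfield L)) L (IsCMField.complexConj L) 3 ((StdForm.antidiagonal 3).over L) b * a) = ca b * Φa a)
    (hΦfB : ∀ (b : (quasiSplit (↥(maximalRealSubfield L)) L (IsCMField.complexConj L) 3).Adelic), b ∈ borelAdelic (↥(maximalRealSubfield L)) L (IsCMField.complexConj L) 3 →
      ∀ u, Φf (finPart (↥(maximalRealSubfield L)) L (IsCMField.complexConj L) 3 ((StdForm.antidiagonal 3).over L) b * u) = cf b * Φf u) :
    IsChiSectionPair χ₁ χ₂ (fun g : (quasiSplit (↥(maximalRealSubfield L)) L (IsCMField.complexConj L) 3).Adelic =>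
      Φa (archPart (↥(maximalRealSubfield L)) L (IsCMField.complexConj L) 3 ((StdForm.antidiagonal 3).over L) g) *
        Φf (finPart (↥(maximalRealSubfield L)) L (IsCMField.complexConj L) 3 ((StdForm.antidiagonal 3).over L) g)) := fun b hb g => by
  simp only [map_mul, hΦaB b hb, hΦfB b hb]
  linear_combination (Φa (archPart (↥(maximalRealSubfield L)) L (IsCMField.complexConj L) 3 ((StdForm.antidiagonal 3).over L) g) *
    Φf (finPart (↥(maximalRealSubfield L)) L (IsCMField.complexConj L) 3 ((StdForm.antidiagonal 3).over L) g)) * hc b hb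

/-- **`φ(g·ι_f(u)) = φ(g)` for `u ∈ Kf`**: `(ι_f u)_∞ = 1`, `(ι_f u)_f = u` (★ `archPart_finAdelicToAdelic`, ★ `finPart_finAdelicToAdelic`) and the right-`Kf`-invariance letter `hΦfK`. [cite: BorelJacquet1979, §4.1] -/
theorem archFin_apply_mul_finAdelicToAdelic
    (hΦfK : ∀ u, ∀ k ∈ Kf, Φf (u * k) = Φf u) (g : (quasiSplit (↥(maximalRealSubfield L)) L (IsCMField.complexConj L) 3).Adelic) {k : ↥(finAdelic (↥(maximalRealSubfield L)) L (IsCMField.complexConj L) 3 ((StdForm.antidiagonal 3).over L))} (hk : k ∈ Kf) :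
    Φa (archPart (↥(maximalRealSubfield L)) L (IsCMField.complexConj L) 3 ((StdForm.antidiagonal 3).over L) (g * finAdelicToAdelic (↥(maximalRealSubfield L)) L (IsCMField.complexConj L) 3 ((StdForm.antidiagonal 3).over L) k)) *
        Φf (finPart (↥(maximalRealSubfield L)) L (IsCMField.complexConj L) 3 ((StdForm.antidiagonal 3).over L) (g * finAdelicToAdelic (↥(maximalRealSubfield L)) L (IsCMField.complexConj L) 3 ((StdForm.antidiagonal 3).over L) k)) =
      Φa (archPart (↥(maximalRealSubfield L)) L (IsCMField.complexConj L) 3 ((StdForm.antidiagonal 3).over L) g) * Φf (finPart (↥(maximalRealSubfield L)) L (IsCMField.complexConj L) 3 ((StdForm.antidiagonal 3).over L) g) := by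
  rw [map_mul, map_mul, archPart_finAdelicToAdelic, mul_one, finPart_finAdelicToAdelic, hΦfK _ k hk]

/-- **`φ ∈ V(χ₁, χ₂; ι_f(Kf), 1)`** — both laws of ★ `chiSectionSpacePair` at the level `K′ := Kf.map ι_f`, `ω := 1`. [cite: MoeglinWaldspurger1995, I.2.17] -/
theorem archFin_mem_chiSectionSpacePair
    (hc : ∀ (b : (quasiSplit (↥(maximalRealSubfield L)) L (IsCMField.complexConj L) 3).Adelic) (hb : b ∈ borelAdelic (↥(maximalRealSubfield L)) L (IsCMField.complexConj L) 3),
      ca b * cf b = ((χ₁ (firstEntryUnit hb) : ℂˣ) : ℂ) * ((χ₂ (middleEntryUnitary hb) : ℂˣ) : ℂ))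
    (hΦaB : ∀ (b : (quasiSplit (↥(maximalRealSubfield L)) L (IsCMField.complexConj L) 3).Adelic), b ∈ borelAdelic (↥(maximalRealSubfield L)) L (IsCMField.complexConj L) 3 →
      ∀ a, Φa (archPart (↥(maximalRealSubfield L)) L (IsCMField.complexConj L) 3 ((StdForm.antidiagonal 3).over L) b * a) = ca b * Φa a)
    (hΦfB : ∀ (b : (quasiSplit (↥(maximalRealSubfield L)) L (IsCMField.complexConj L) 3).Adelic), b ∈ borelAdelic (↥(maximalRealSubfield L)) L (IsCMField.complexConj L) 3 →
      ∀ u, Φf (finPart (↥(maximalRealSubfield L)) L (IsCMField.complexConj L) 3 ((StdForm.antidiagonal 3).over L) b * u) = cf b * Φf u)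
    (hΦfK : ∀ u, ∀ k ∈ Kf, Φf (u * k) = Φf u) :
    (fun g : (quasiSplit (↥(maximalRealSubfield L)) L (IsCMField.complexConj L) 3).Adelic =>
      Φa (archPart (↥(maximalRealSubfield L)) L (IsCMField.complexConj L) 3 ((StdForm.antidiagonal 3).over L) g) *
        Φf (finPart (↥(maximalRealSubfield L)) L (IsCMField.complexConj L) 3 ((StdForm.antidiagonal 3).over L) g)) ∈
      chiSectionSpacePair χ₁ χ₂ (Kf.map (finAdelicToAdelic (↥(maximalRealSubfield L)) L (IsCMField.complexConj L) 3 ((StdForm.antidiagonal 3).over L)))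
        ((1 : ↥(Kf.map (finAdelicToAdelic (↥(maximalRealSubfield L)) L (IsCMField.complexConj L) 3 ((StdForm.antidiagonal 3).over L))) →* ℂ) :
          ↥(Kf.map (finAdelicToAdelic (↥(maximalRealSubfield L)) L (IsCMField.complexConj L) 3 ((StdForm.antidiagonal 3).over L))) → ℂ) := by
  refine mem_chiSectionSpacePair (archFin_isChiSectionPair L ca cf Φa Φf hc hΦaB hΦfB) fun g k => ?_
  obtain ⟨u, hu, hku⟩ := Subgroup.mem_map.1 k.2
  rw [MonoidHom.one_apply, one_mul]
  show Φa (archPart (↥(maximalRealSubfield L)) L (IsCMField.complexConj L) 3 ((StdForm.antidiagonal 3).over L) (g * (k : (quasiSplit (↥(maximalRealSubfield L)) L (IsCMField.complexConj L) 3).Adelic))) *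
      Φf (finPart (↥(maximalRealSubfield L)) L (IsCMField.complexConj L) 3 ((StdForm.antidiagonal 3).over L) (g * (k : (quasiSplit (↥(maximalRealSubfield L)) L (IsCMField.complexConj L) 3).Adelic))) = _
  rw [← hku]
  exact archFin_apply_mul_finAdelicToAdelic L Φa Φf Kf hΦfK g hu

/-- **`φ` is continuous** (★ `continuous_archPart`, ★ `continuous_finPart`, the letters `hΦac`, `hΦfc`). [cite: BorelJacquet1979, §4.1] -/
theorem continuous_archFin (hΦac : Continuous Φa) (hΦfc : Continuous Φf) :
    Continuous (fun g : (quasiSplit (↥(maximalRealSubfield L)) L (IsCMField.complexConj L) 3).Adelic =>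
      Φa (archPart (↥(maximalRealSubfield L)) L (IsCMField.complexConj L) 3 ((StdForm.antidiagonal 3).over L) g) *
        Φf (finPart (↥(maximalRealSubfield L)) L (IsCMField.complexConj L) 3 ((StdForm.antidiagonal 3).over L) g)) :=
  (hΦac.comp (continuous_archPart (↥(maximalRealSubfield L)) L (IsCMField.complexConj L) 3 ((StdForm.antidiagonal 3).over L))).mul
    (hΦfc.comp (continuous_finPart (↥(maximalRealSubfield L)) L (IsCMField.complexConj L) 3 ((StdForm.antidiagonal 3).over L)))

/-- **`φ(1) = Φa(1)·Φf(1)`**. [folklore] -/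
theorem archFin_apply_one :
    (fun g : (quasiSplit (↥(maximalRealSubfield L)) L (IsCMField.complexConj L) 3).Adelic =>
      Φa (archPart (↥(maximalRealSubfield L)) L (IsCMField.complexConj L) 3 ((StdForm.antidiagonal 3).over L) g) *
        Φf (finPart (↥(maximalRealSubfield L)) L (IsCMField.complexConj L) 3 ((StdForm.antidiagonal 3).over L) g)) 1 = Φa 1 * Φf 1 := by
  simp only [map_one]

/-! ## §2 The export of the (V) discharge table, row (i) -/

/-- **THE WITNESS AT THE VISIBLE LEVEL `(ι_f(Kf), 1)`**: under the letters of §1 and `Φa 1 ≠ 0`, `Φf 1 ≠ 0`, there is `φ ∈ V(χ₁, χ₂; Kf.map ι_f, 1)`, continuous, with `φ 1 ≠ 0` — the form a consumer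
keys the atom `resGMidAtom ξ μω (Kf.map ι_f) 1` to. [cite: MoeglinWaldspurger1995, I.2.17] [cite: BorelJacquet1979, §4.1] -/
theorem exists_mem_chiSectionSpacePair_map_finAdelicToAdelic_of_letters
    (hc : ∀ (b : (quasiSplit (↥(maximalRealSubfield L)) L (IsCMField.complexConj L) 3).Adelic) (hb : b ∈ borelAdelic (↥(maximalRealSubfield L)) L (IsCMField.complexConj L) 3),
      ca b * cf b = ((χ₁ (firstEntryUnit hb) : ℂˣ) : ℂ) * ((χ₂ (middleEntryUnitary hb) : ℂˣ) : ℂ))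
    (hΦac : Continuous Φa)
    (hΦaB : ∀ (b : (quasiSplit (↥(maximalRealSubfield L)) L (IsCMField.complexConj L) 3).Adelic), b ∈ borelAdelic (↥(maximalRealSubfield L)) L (IsCMField.complexConj L) 3 →
      ∀ a, Φa (archPart (↥(maximalRealSubfield L)) L (IsCMField.complexConj L) 3 ((StdForm.antidiagonal 3).over L) b * a) = ca b * Φa a)
    (hΦa1 : Φa 1 ≠ 0) (hΦfc : Continuous Φf)
    (hΦfB : ∀ (b : (quasiSplit (↥(maximalRealSubfield L)) L (IsCMField.complexConj L) 3).Adelic), b ∈ borelAdelic (↥(maximalRealSubfield L)) L (IsCMField.complexConj L) 3 →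
      ∀ u, Φf (finPart (↥(maximalRealSubfield L)) L (IsCMField.complexConj L) 3 ((StdForm.antidiagonal 3).over L) b * u) = cf b * Φf u)
    (hΦfK : ∀ u, ∀ k ∈ Kf, Φf (u * k) = Φf u) (hΦf1 : Φf 1 ≠ 0) :
    ∃ φ : (quasiSplit (↥(maximalRealSubfield L)) L (IsCMField.complexConj L) 3).Adelic → ℂ,
      φ ∈ chiSectionSpacePair χ₁ χ₂ (Kf.map (finAdelicToAdelic (↥(maximalRealSubfield L)) L (IsCMField.complexConj L) 3 ((StdForm.antidiagonal 3).over L)))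
          ((1 : ↥(Kf.map (finAdelicToAdelic (↥(maximalRealSubfield L)) L (IsCMField.complexConj L) 3 ((StdForm.antidiagonal 3).over L))) →* ℂ) :
            ↥(Kf.map (finAdelicToAdelic (↥(maximalRealSubfield L)) L (IsCMField.complexConj L) 3 ((StdForm.antidiagonal 3).over L))) → ℂ) ∧
        Continuous φ ∧ φ 1 ≠ 0 :=
  ⟨_, archFin_mem_chiSectionSpacePair L ca cf Φa Φf Kf hc hΦaB hΦfB hΦfK, continuous_archFin L Φa Φf hΦac hΦfc, by
    show Φa (archPart (↥(maximalRealSubfield L)) L (IsCMField.complexConj L) 3 ((StdForm.antidiagonal 3).over L) 1) *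
        Φf (finPart (↥(maximalRealSubfield L)) L (IsCMField.complexConj L) 3 ((StdForm.antidiagonal 3).over L) 1) ≠ 0
    rw [map_one, map_one]; exact mul_ne_zero hΦa1 hΦf1⟩

/-- **THE EXPORT (row (i) of the (V) discharge table), HYPOTHESIS-FIRST: `∃ K′ ω φ, φ ∈ V(χ₁, χ₂; K′, ω) ∧ Continuous φ ∧ φ 1 ≠ 0`** for ANY pair `(χ₁, χ₂)` — in particular the (V) pair
`(ξ.bcη⁻¹·ξ.bcψ⁻¹·μω, ξ.ψ)` — from an archimedean section (`Φa`, `hΦac hΦaB hΦa1`; census road (A), FILE 3) and a finite-adelic level section (`Φf`, `hΦfc hΦfB hΦfK hΦf1`; FILE 2) with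
compatible Borel multipliers (`hc`).  Witness: `K′ := Kf.map ι_f`, `ω := 1`, `φ := Φa(·_∞)·Φf(·_f)`. [cite: MoeglinWaldspurger1995, I.2.17] [cite: BorelJacquet1979, §4.1] -/
theorem exists_chiSectionPair_continuous_apply_one_ne_zero_of_letters
    (hc : ∀ (b : (quasiSplit (↥(maximalRealSubfield L)) L (IsCMField.complexConj L) 3).Adelic) (hb : b ∈ borelAdelic (↥(maximalRealSubfield L)) L (IsCMField.complexConj L) 3),
      ca b * cf b = ((χ₁ (firstEntryUnit hb) : ℂˣ) : ℂ) * ((χ₂ (middleEntryUnitary hb) : ℂˣ) : ℂ))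
    (hΦac : Continuous Φa)
    (hΦaB : ∀ (b : (quasiSplit (↥(maximalRealSubfield L)) L (IsCMField.complexConj L) 3).Adelic), b ∈ borelAdelic (↥(maximalRealSubfield L)) L (IsCMField.complexConj L) 3 →
      ∀ a, Φa (archPart (↥(maximalRealSubfield L)) L (IsCMField.complexConj L) 3 ((StdForm.antidiagonal 3).over L) b * a) = ca b * Φa a)
    (hΦa1 : Φa 1 ≠ 0) (hΦfc : Continuous Φf)
    (hΦfB : ∀ (b : (quasiSplit (↥(maximalRealSubfield L)) L (IsCMField.complexConj L) 3).Adelic), b ∈ borelAdelic (↥(maximalRealSubfield L)) L (IsCMField.complexConj L) 3 →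
      ∀ u, Φf (finPart (↥(maximalRealSubfield L)) L (IsCMField.complexConj L) 3 ((StdForm.antidiagonal 3).over L) b * u) = cf b * Φf u)
    (hΦfK : ∀ u, ∀ k ∈ Kf, Φf (u * k) = Φf u) (hΦf1 : Φf 1 ≠ 0) :
    ∃ (K' : Subgroup (quasiSplit (↥(maximalRealSubfield L)) L (IsCMField.complexConj L) 3).Adelic) (ω : ↥K' →* ℂ)
      (φ : (quasiSplit (↥(maximalRealSubfield L)) L (IsCMField.complexConj L) 3).Adelic → ℂ),
      φ ∈ chiSectionSpacePair χ₁ χ₂ K' (ω : ↥K' → ℂ) ∧ Continuous φ ∧ φ 1 ≠ 0 := by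
  obtain ⟨φ, hφ, hφc, hφ1⟩ := exists_mem_chiSectionSpacePair_map_finAdelicToAdelic_of_letters L ca cf Φa Φf Kf hc hΦac hΦaB hΦa1 hΦfc hΦfB hΦfK hΦf1
  exact ⟨_, 1, φ, hφ, hφc, hφ1⟩

end Glue

end Summit.HodgeConjecture.HodgeConjecture.R90.S8

end
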